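import Summits.BirchSwinnertonDyer.Uniform.U2.RouteBRankDichotomy
import Summits.BirchSwinnertonDyer.Uniform.U2.TransportB
import Summits.BirchSwinnertonDyer.Uniform.U2.CorC
import HarnessLib

/-!
# Cell «bsd-uniform», track U2, ROUTE B — END-TO-END ASSEMBLY (rank-one base, no flip):
# `BSD(E^{(d)}, 2) ∧ BSD(E^{(dD)}, 2)` with `r_an(E^{(d)}) = 1`, from the three route-B layers

HONEST FRAMING (cell «bsd-uniform», HOME `run/shared/lean/pub/bsd-uniform/`, seat u2-p2). What this file
IS: the COMPOSITION CHECK of route B — it chains the landed layers `RouteBRankDichotomy` (Thm A′ shape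
from ONE analytic binder `hGZ`), `TransportB` (Thm B′ `Ш[2]`-half from route A's Selmer transport) and
`CorC` ((※)/Cor C bookkeeping) into ONE theorem for the case the cell cares about most (T4-PROOF §7:
"the 2-part of BSD for the RANK-ONE twist"): base `E` of analytic rank `1`, partner `E^{(D)}` of analytic
rank `0` (`K = ℚ(√D)` Heegner, `D ≡ 1 (mod 4)`), twisting parameter `d = M* ≡ 1 (mod 4)` with NO FLIP
(`χ_d(−N) = sign d · J(N | |d|) = 1`, i.e. `h_∞(d) = 0` by `GenusTwistSignLaw`). Every deep input stays
an explicit binder, now visibly SORTED by provenance: Modularity/parity/GZK (tree named facts); the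
genus-point combination + CST explicit Gross–Zagier (`hGZ`); route A's two Selmer transports
(`hSel₁`, `hSel₂`); the class predicates (H-2), `Ш[2] = 0` of the base pair; the (※) identity with its
odd indices (L5) — itself assembled by `CorC.gzQuotient_identity`/`shaAn_mul_shaAn_genusPair` from
(I1)/(L5)/(L6); Tamagawa balance (L3); Zhai's unit for the rank-`0` member; the base-pair certificates
`BSDp W 2`, `BSDp W₀ 2`. CONCLUSION (PROVED): `BSDp W₁ 2 ∧ BSDp W₂ 2`, `r_an(W₁) = 1`, `r_an(W₂) = 0`.
What this file is NOT: no binder is discharged here; nothing is booked; per-base inputs ((H-y) inside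
`hGZ`, the base certificates) stay per-base (RESIDUE R2-1) — this is a RELATIVE uniform statement
("transport"), exactly as PLAN.md §3 prices it.

Instance note: `TransportB` is stated over a general number field (classical `DecidableEq`); the
`ℚ`-binders `hT·` below are converted with `Subsingleton.elim` on `DecidableEq ℚ` (the tree's idiom,
`Typed/HigherDescentSelmerCertificate`).

References: `p2/idea-2/T4-PROOF.md` v1.9b §§4–7; Kriz–Li 2019 Thm. 1.12 (2) [KrizLi2019] (the (★),
split-prime instance of the same assembly); Zhai 2016 [Zhai2016]; Miller 2011 Def. 1.1 [Miller2011LMS].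
-/

noncomputable section

open scoped Classical NumberTheorySymbols

open WeierstrassCurve Literature.NumberTheory.EllipticCurves
  Literature.NumberTheory.EllipticCurves.ModularForms

namespace Summit.BirchSwinnertonDyer.Uniform.U2

/-- Finite `Ш` ⇒ finite `2`-primary part (a subgroup). [folklore] -/
theorem finite_primaryComponent_sha_of_finite (V : WeierstrassCurve ℚ) (h : Finite V.sha) :
    Finite (AddCommGroup.primaryComponent V.sha 2) := by
  haveI := h
  infer_instance

/-- `Ш[2] = 0` elementwise on the subgroup `Ш ≤ H¹(ℚ, E)` ⇒ `#Ш[2^∞] = 1`. [folklore] -/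
theorem card_primaryComponent_sha_two_eq_one_of_forall (V : WeierstrassCurve ℚ)
    (h : ∀ x : V.galH1, x ∈ V.sha → 2 • x = 0 → x = 0) :
    Nat.card (AddCommGroup.primaryComponent V.sha 2) = 1 :=
  card_primaryComponent_eq_one_of_forall (fun x hx =>
    Subtype.ext (h x x.2 (by exact_mod_cast congrArg Subtype.val hx)))

/-- **ROUTE B, END-TO-END (rank-one base, no flip): `BSD(E^{(d)}, 2)` and `BSD(E^{(dD)}, 2)`.**
Binders grouped by provenance (module docstring); roles `(A, B, A₀, B₀) = (W₂, W₁, W₀, W)` of `CorC`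
(rank-`0` members `A = E^{(dD)}`, `A₀ = E^{(D)}`; rank-`1` members `B = E^{(d)}`, `B₀ = E`). Proof:
`rank_genusPair_dichotomy_of_models` (+ no flip) gives `r_an(W₁) = 1`, `r_an(W₂) = 0` and the rank
parts; `card_primaryComponent_sha_two_eq_one_of_selmer_transport` twice gives `Ш(W₁)[2^∞] =
Ш(W₂)[2^∞] = 0`; `bsdp_two_genusPair_of_bookkeeping` concludes.
[cite: KrizLi2019, Thm. 1.12 (2) (the split-prime, (★) instance of this assembly)]
[cite: Zhai2016, Thm. 1.1 and 1.2 (binder hZhai)] [cite: Miller2011LMS, Def. 1.1] -/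
theorem bsdp_two_genusPair_rankOne_noFlip
    (W W₀ W₁ W₂ : WeierstrassCurve ℚ) [W.IsElliptic] [W₀.IsElliptic] [W₁.IsElliptic] [W₂.IsElliptic]
    -- Modularity, parity, Gross–Zagier–Kolyvagin over `ℚ` (tree named facts)
    (hmod : exists_isNewformOf) (hE : hasEntireLFunction_rat)
    (hpar : ∀ V : WeierstrassCurve ℚ, V.even_analyticRank_iff)
    (hGZK : rank_eq_analyticRank_of_analyticRank_le_one)
    -- the twisting data `d = M*`, `D = d_K` and the models `W₁ ≅ E^{(d)}`, `W₂ ≅ E^{(dD)}`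
    -- (`W₀` is INTENDED to be a model of `E^{(D)}`; the theorem uses only the listed properties of `W₀`)
    {d D : ℤ} (hd4 : d % 4 = 1) (hD4 : D % 4 = 1) (hsqf : Squarefree (d * D))
    (hgcd : Int.gcd (d * D) (W.conductorNorm ℤ) = 1)
    (hχ : J(-1 | D.natAbs) * J((W.conductorNorm ℤ : ℤ) | D.natAbs) = -1)
    (h₁ : ∃ C : VariableChange ℚ, C • W₁ = W.quadraticTwist (d : ℚ))
    (h₂ : ∃ C : VariableChange ℚ, C • W₂ = W.quadraticTwist ((d * D : ℤ) : ℚ))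
    -- base pair ranks and NO FLIP (`χ_d(−N) = 1`, i.e. `h_∞(d) = 0` by `GenusTwistSignLaw`)
    (hr : W.analyticRank = 1) (hr₀ : W₀.analyticRank = 0)
    (hsign : Int.sign d * J((W.conductorNorm ℤ : ℤ) | d.natAbs) = 1)
    -- THE COMBINATION → CST explicit Gross–Zagier: `L'(1, E, χ) ≠ 0`
    (hGZ : deriv (fun s => (W.quadraticTwist (d : ℚ)).entireLFunction s *
        (W.quadraticTwist ((d * D : ℤ) : ℚ)).entireLFunction s) 1 ≠ 0)
    -- ROUTE A: the two Selmer transports (Kramer / Mazur–Rubin / Kramer–Tunnell §6 at the prime `2`)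
    (hSel₁ : Nat.card (W₁.selmerGroup ((2 : ℕ) : ℤ)) = Nat.card (W.selmerGroup ((2 : ℕ) : ℤ)))
    (hSel₂ : Nat.card (W₂.selmerGroup ((2 : ℕ) : ℤ)) = Nat.card (W₀.selmerGroup ((2 : ℕ) : ℤ)))
    -- (H-2) for the four curves; `Ш[2] = 0` for the base pair
    (hT : ∀ P : W.toAffine.Point, 2 • P = 0 → P = 0)
    (hT₀ : ∀ P : W₀.toAffine.Point, 2 • P = 0 → P = 0)
    (hT₁ : ∀ P : W₁.toAffine.Point, 2 • P = 0 → P = 0)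
    (hT₂ : ∀ P : W₂.toAffine.Point, 2 • P = 0 → P = 0)
    (hSha : ∀ x : W.galH1, x ∈ W.sha → 2 • x = 0 → x = 0)
    (hSha₀ : ∀ x : W₀.galH1, x ∈ W₀.sha → 2 • x = 0 → x = 0)
    -- (※) with its odd indices (L5), odd torsion ((H-2)), Tamagawa balance (L3)
    {n m : ℕ} (hn : Odd n) (hm : Odd m)
    (hId : shaAn W₂ * shaAn W₁ * ((m : ℂ) ^ 2 * ((W₀.torsionOrder : ℂ) ^ 2 * (W.torsionOrder : ℂ) ^ 2) *
        ((W₂.tamagawaProduct : ℂ) * (W₁.tamagawaProduct : ℂ))) =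
      shaAn W₀ * shaAn W * ((n : ℂ) ^ 2 * ((W₂.torsionOrder : ℂ) ^ 2 * (W₁.torsionOrder : ℂ) ^ 2) *
        ((W₀.tamagawaProduct : ℂ) * (W.tamagawaProduct : ℂ))))
    (hTo : Odd W.torsionOrder) (hTo₀ : Odd W₀.torsionOrder) (hTo₁ : Odd W₁.torsionOrder)
    (hTo₂ : Odd W₂.torsionOrder)
    (hc : padicValNat 2 (W₂.tamagawaProduct * W₁.tamagawaProduct) =
      padicValNat 2 (W₀.tamagawaProduct * W.tamagawaProduct))
    -- the base-pair certificates and Zhai's unit for the rank-`0` member `W₂ = E^{(dD)}`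
    (hbsd : BSDp W 2) (hbsd₀ : BSDp W₀ 2)
    (hZhai : ∃ q : ℚ, W₂.leadingLCoeff = (q : ℂ) * (W₂.realPeriodRat : ℂ) ∧ q ≠ 0 ∧
      padicValRat 2 q = 0)
    (hReg₂ : W₂.regulator = 1) (hc₂ : Odd W₂.tamagawaProduct) :
    BSDp W₁ 2 ∧ BSDp W₂ 2 ∧ W₁.analyticRank = 1 ∧ W₂.analyticRank = 0 := by
  -- layer: rank dichotomy (Thm A′ shape) + no flip
  obtain ⟨hm₁, hm₂, hf₁, hf₂, hdich, hiff⟩ :=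
    rank_genusPair_dichotomy_of_models W hmod hE hpar hGZK hd4 hD4 hsqf hgcd hχ (by omega) hGZ
      W₁ W₂ h₁ h₂
  have hr₁ : W₁.analyticRank = 1 := by rw [hiff.2 hsign, hr]
  have hr₂ : W₂.analyticRank = 0 := by
    rcases hdich with ⟨-, h⟩ | ⟨h, -⟩
    · exact h
    · omega
  obtain ⟨hmW, hfW⟩ := hGZK W (by omega)
  obtain ⟨hmW₀, hfW₀⟩ := hGZK W₀ (by omega)
  have hrk₁ : W₁.mordellWeilRank = W.mordellWeilRank := by rw [hm₁, hmW, hr₁, hr]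
  have hrk₂ : W₂.mordellWeilRank = W₀.mordellWeilRank := by rw [hm₂, hmW₀, hr₂, hr₀]
  -- layer: Thm B′ from route A's transports (classical `DecidableEq ℚ` for the general-`K` lemma)
  have hinst : (instDecidableEqRat : DecidableEq ℚ) = fun a b => Classical.propDecidable (a = b) :=
    Subsingleton.elim _ _
  rw [hinst] at hT hT₀ hT₁ hT₂
  have hSha₁ := card_primaryComponent_sha_two_eq_one_of_selmer_transport W W₁ hSel₁ hT hT₁ hSha hrk₁
  have hSha₂ :=
    card_primaryComponent_sha_two_eq_one_of_selmer_transport W₀ W₂ hSel₂ hT₀ hT₂ hSha₀ hrk₂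
  -- layer: Cor C bookkeeping with roles (A, B, A₀, B₀) = (W₂, W₁, W₀, W)
  obtain ⟨hA, hB⟩ := bsdp_two_genusPair_of_bookkeeping W₂ W₁ W₀ W hE hn hm hId hTo₂ hTo₁ hTo₀ hTo
    hc hbsd₀ hbsd (card_primaryComponent_sha_two_eq_one_of_forall W₀ hSha₀)
    (card_primaryComponent_sha_two_eq_one_of_forall W hSha) hZhai hReg₂ hc₂ hSha₂ hSha₁ hm₂ hm₁
    (finite_primaryComponent_sha_of_finite W₂ hf₂) (finite_primaryComponent_sha_of_finite W₁ hf₁)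
  exact ⟨hB, hA, hr₁, hr₂⟩

/-- **ROUTE B, END-TO-END (rank-zero base, no flip): `BSD(E^{(d)}, 2)` and `BSD(E^{(dD)}, 2)`** — the
twin of `bsdp_two_genusPair_rankOne_noFlip` for `r_an(E) = 0`, `r_an(E^{(D)}) = 1`: roles
`(A, B, A₀, B₀) = (W₁, W₂, W, W₀)`, Zhai's unit for `W₁ = E^{(d)}`; here the RANK-ONE member with
`BSD(·, 2)` is the partner `W₂ = E^{(dD)}`. [cite: KrizLi2019, Thm. 1.12 (2) (the split-prime, (★) instance)]
[cite: Zhai2016, Thm. 1.1 and 1.2 (binder hZhai)] [cite: Miller2011LMS, Def. 1.1] -/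
theorem bsdp_two_genusPair_rankZero_noFlip
    (W W₀ W₁ W₂ : WeierstrassCurve ℚ) [W.IsElliptic] [W₀.IsElliptic] [W₁.IsElliptic] [W₂.IsElliptic]
    (hmod : exists_isNewformOf) (hE : hasEntireLFunction_rat)
    (hpar : ∀ V : WeierstrassCurve ℚ, V.even_analyticRank_iff)
    (hGZK : rank_eq_analyticRank_of_analyticRank_le_one)
    {d D : ℤ} (hd4 : d % 4 = 1) (hD4 : D % 4 = 1) (hsqf : Squarefree (d * D))
    (hgcd : Int.gcd (d * D) (W.conductorNorm ℤ) = 1)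
    (hχ : J(-1 | D.natAbs) * J((W.conductorNorm ℤ : ℤ) | D.natAbs) = -1)
    (h₁ : ∃ C : VariableChange ℚ, C • W₁ = W.quadraticTwist (d : ℚ))
    (h₂ : ∃ C : VariableChange ℚ, C • W₂ = W.quadraticTwist ((d * D : ℤ) : ℚ))
    (hr : W.analyticRank = 0) (hr₀ : W₀.analyticRank = 1)
    (hsign : Int.sign d * J((W.conductorNorm ℤ : ℤ) | d.natAbs) = 1)
    (hGZ : deriv (fun s => (W.quadraticTwist (d : ℚ)).entireLFunction s *
        (W.quadraticTwist ((d * D : ℤ) : ℚ)).entireLFunction s) 1 ≠ 0)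
    (hSel₁ : Nat.card (W₁.selmerGroup ((2 : ℕ) : ℤ)) = Nat.card (W.selmerGroup ((2 : ℕ) : ℤ)))
    (hSel₂ : Nat.card (W₂.selmerGroup ((2 : ℕ) : ℤ)) = Nat.card (W₀.selmerGroup ((2 : ℕ) : ℤ)))
    (hT : ∀ P : W.toAffine.Point, 2 • P = 0 → P = 0)
    (hT₀ : ∀ P : W₀.toAffine.Point, 2 • P = 0 → P = 0)
    (hT₁ : ∀ P : W₁.toAffine.Point, 2 • P = 0 → P = 0)
    (hT₂ : ∀ P : W₂.toAffine.Point, 2 • P = 0 → P = 0)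
    (hSha : ∀ x : W.galH1, x ∈ W.sha → 2 • x = 0 → x = 0)
    (hSha₀ : ∀ x : W₀.galH1, x ∈ W₀.sha → 2 • x = 0 → x = 0)
    {n m : ℕ} (hn : Odd n) (hm : Odd m)
    (hId : shaAn W₁ * shaAn W₂ * ((m : ℂ) ^ 2 * ((W.torsionOrder : ℂ) ^ 2 * (W₀.torsionOrder : ℂ) ^ 2) *
        ((W₁.tamagawaProduct : ℂ) * (W₂.tamagawaProduct : ℂ))) =
      shaAn W * shaAn W₀ * ((n : ℂ) ^ 2 * ((W₁.torsionOrder : ℂ) ^ 2 * (W₂.torsionOrder : ℂ) ^ 2) *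
        ((W.tamagawaProduct : ℂ) * (W₀.tamagawaProduct : ℂ))))
    (hTo : Odd W.torsionOrder) (hTo₀ : Odd W₀.torsionOrder) (hTo₁ : Odd W₁.torsionOrder)
    (hTo₂ : Odd W₂.torsionOrder)
    (hc : padicValNat 2 (W₁.tamagawaProduct * W₂.tamagawaProduct) =
      padicValNat 2 (W.tamagawaProduct * W₀.tamagawaProduct))
    (hbsd : BSDp W 2) (hbsd₀ : BSDp W₀ 2)
    (hZhai : ∃ q : ℚ, W₁.leadingLCoeff = (q : ℂ) * (W₁.realPeriodRat : ℂ) ∧ q ≠ 0 ∧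
      padicValRat 2 q = 0)
    (hReg₁ : W₁.regulator = 1) (hc₁ : Odd W₁.tamagawaProduct) :
    BSDp W₁ 2 ∧ BSDp W₂ 2 ∧ W₁.analyticRank = 0 ∧ W₂.analyticRank = 1 := by
  obtain ⟨hm₁, hm₂, hf₁, hf₂, hdich, hiff⟩ :=
    rank_genusPair_dichotomy_of_models W hmod hE hpar hGZK hd4 hD4 hsqf hgcd hχ (by omega) hGZ
      W₁ W₂ h₁ h₂
  have hr₁ : W₁.analyticRank = 0 := by rw [hiff.2 hsign, hr]
  have hr₂ : W₂.analyticRank = 1 := by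
    rcases hdich with ⟨h, -⟩ | ⟨-, h⟩
    · omega
    · exact h
  obtain ⟨hmW, hfW⟩ := hGZK W (by omega)
  obtain ⟨hmW₀, hfW₀⟩ := hGZK W₀ (by omega)
  have hrk₁ : W₁.mordellWeilRank = W.mordellWeilRank := by rw [hm₁, hmW, hr₁, hr]
  have hrk₂ : W₂.mordellWeilRank = W₀.mordellWeilRank := by rw [hm₂, hmW₀, hr₂, hr₀]
  have hinst : (instDecidableEqRat : DecidableEq ℚ) = fun a b => Classical.propDecidable (a = b) :=
    Subsingleton.elim _ _
  rw [hinst] at hT hT₀ hT₁ hT₂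
  have hSha₁ := card_primaryComponent_sha_two_eq_one_of_selmer_transport W W₁ hSel₁ hT hT₁ hSha hrk₁
  have hSha₂ :=
    card_primaryComponent_sha_two_eq_one_of_selmer_transport W₀ W₂ hSel₂ hT₀ hT₂ hSha₀ hrk₂
  obtain ⟨hA, hB⟩ := bsdp_two_genusPair_of_bookkeeping W₁ W₂ W W₀ hE hn hm hId hTo₁ hTo₂ hTo hTo₀
    hc hbsd hbsd₀ (card_primaryComponent_sha_two_eq_one_of_forall W hSha)
    (card_primaryComponent_sha_two_eq_one_of_forall W₀ hSha₀) hZhai hReg₁ hc₁ hSha₁ hSha₂ hm₁ hm₂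
    (finite_primaryComponent_sha_of_finite W₁ hf₁) (finite_primaryComponent_sha_of_finite W₂ hf₂)
  exact ⟨hA, hB, hr₁, hr₂⟩

end Summit.BirchSwinnertonDyer.Uniform.U2

end
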